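import Mathlib.Analysis.SpecificLimits.Normed
import Mathlib.Analysis.Asymptotics.SpecificAsymptotics
import Literature.Computability.Cryptography.LWENoise
import Literature.Computability.Complexity.Classes
import HarnessLib

/-!
# Regev's decision-to-search reduction, V: the polynomial parameters and the asymptotic error bound

Topic `Computability/Cryptography` (LWE), grouping namespace `LWE.RegevReduction`. The core bound
of the reduction (`LWERegevCore.lean`, `LWERegevSampling.lean`) is, for advantage `ε`, accuracy
`η`, `T` shifts, `N` repetitions, `K`-bit coin chunks and `m` samples per oracle call,

  `Pr[fail] ≤ T (nq+1)/(4Nη²) + (1 - ε/2)^T + L q / 2^K`,  `L = T n + T (nq+1) N m`.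

Regev (2009, §4, proof of Lemma 4.1) takes `n^{c₁+1}` iterations and `O(n^{2c₂+1})` calls per
estimate for an `n^{-c₁}` fraction of good secrets and advantage `n^{-c₂}`. Here, for the
average-case advantage `ε = 1/n^c` of `regev_decision_to_search` (`LWEHardness.lean`; good
fraction and gap both `≥ ε/2`) and target error `1/n^{c'}`, we fix the POLYNOMIAL parameter
functions the oracle machine computes from `n` and `q`,

  `Tpar c c' n = n^{c+c'+1}`,  `Npar c c' n q = n^{3c+2c'+3} q`,  `K = n`,  `η = ε/16`,

and prove the calculus fact **`eventually_failureBound_le`**: for polynomially bounded `q, m` the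
bound is `≤ 1/n^{c'}` for all large `n` (term by term: `128/n^{c'+1}`, `2/n^{c'+1}` by Bernoulli's
inequality, and `poly(n)/2^n ≤ 1/n^{c'+1}`).

## References

* O. Regev, *On lattices, learning with errors, random linear codes, and cryptography*, J. ACM 56
  (2009), art. 34, §4, proof of Lemma 4.1 (the choice of the number of iterations and of calls).
  [cite: RegevLWE2009, §4 Lemma 4.1 (proof)]
-/

namespace Literature.Computability.Cryptography

namespace LWE

namespace RegevReduction

open Filter Literature.Computability.Complexity

/-! ### The parameters -/

/-- The number of random shifts: `T = n^{c+c'+1}`. [cite: RegevLWE2009, §4 Lemma 4.1 (proof: "repeat the following n^{c₁+1} times")] -/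
def Tpar (c c' n : ℕ) : ℕ := n ^ (c + c' + 1)

/-- The number of repetitions per estimate: `N = n^{3c+2c'+3} q`. [cite: RegevLWE2009, §4 Lemma 4.1 (proof: "calling W O(n^{2c₂+1}) times")] -/
def Npar (c c' n q : ℕ) : ℕ := n ^ (3 * c + 2 * c' + 3) * q

/-- `Tpar` is positive for `n ≥ 1`. [folklore] -/
theorem Tpar_pos {c c' n : ℕ} (hn : 0 < n) : 0 < Tpar c c' n := Nat.pow_pos hn

/-- `Npar` is positive for `n, q ≥ 1`. [folklore] -/
theorem Npar_pos {c c' n q : ℕ} (hn : 0 < n) (hq : 0 < q) : 0 < Npar c c' n q :=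
  Nat.mul_pos (Nat.pow_pos hn) hq

/-! ### Calculus lemmas -/

/-- Bernoulli: `(1 - y)^T ≤ 1 / (1 + T y)` for `0 ≤ y ≤ 1`. [folklore] -/
theorem one_sub_pow_le_inv (y : ℝ) (hy0 : 0 ≤ y) (hy1 : y ≤ 1) (T : ℕ) :
    (1 - y) ^ T ≤ 1 / (1 + T * y) := by
  have hB : 1 + (T : ℝ) * y ≤ (1 + y) ^ T := one_add_mul_le_pow (by linarith) T
  have hpos : 0 < 1 + (T : ℝ) * y := by positivity
  rw [le_div_iff₀ hpos]
  have h1 : (1 - y) ^ T * (1 + y) ^ T ≤ 1 := by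
    rw [← mul_pow]
    have : (1 - y) * (1 + y) ≤ 1 := by nlinarith
    exact pow_le_one₀ (by nlinarith) this
  calc (1 - y) ^ T * (1 + T * y) ≤ (1 - y) ^ T * (1 + y) ^ T :=
        mul_le_mul_of_nonneg_left hB (pow_nonneg (by linarith) T)
    _ ≤ 1 := h1

/-- `(1 - ε/2)^T ≤ 2 / (T ε)` for `0 < ε ≤ 2`, `T ≥ 1`. [folklore] -/
theorem one_sub_half_pow_le {ε : ℝ} (hε0 : 0 < ε) (hε2 : ε ≤ 2) {T : ℕ} (hT : 0 < T) :
    (1 - ε / 2) ^ T ≤ 2 / (T * ε) := by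
  have h := one_sub_pow_le_inv (ε / 2) (by linarith) (by linarith) T
  refine h.trans ?_
  have hT' : (0 : ℝ) < T := by exact_mod_cast hT
  rw [div_le_div_iff₀ (by positivity) (by positivity)]
  nlinarith

/-- A polynomially bounded function is eventually below a pure power. [folklore] -/
theorem IsPolyBounded.eventually_le_pow {f : ℕ → ℕ} (hf : IsPolyBounded f) :
    ∃ d : ℕ, ∀ᶠ n : ℕ in atTop, f n ≤ n ^ d := by
  obtain ⟨p, hp⟩ := hf
  obtain ⟨C, k, hCk⟩ := exists_eval_le_mul_pow_add p
  refine ⟨k + 1, ?_⟩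
  filter_upwards [eventually_ge_atTop (2 * C + 1)] with n hn
  calc f n ≤ p.eval n := hp n
    _ ≤ C * n ^ k + C := hCk n
    _ ≤ C * n ^ k + C * n ^ k := by
        have : 1 ≤ n ^ k := Nat.one_le_pow _ _ (by omega)
        nlinarith
    _ = 2 * C * n ^ k := by ring
    _ ≤ n * n ^ k := Nat.mul_le_mul_right _ (by omega)
    _ = n ^ (k + 1) := by ring

/-- `n^k ≤ 2^n / A` eventually, for every `k` and `A > 0`: powers are `o(2^n)`. [folklore] -/
theorem eventually_mul_pow_le_two_pow (k : ℕ) (A : ℝ) :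
    ∀ᶠ n : ℕ in atTop, A * (n : ℝ) ^ k ≤ 2 ^ n := by
  have h := tendsto_pow_const_div_const_pow_of_one_lt k (one_lt_two : (1 : ℝ) < 2)
  rcases le_or_gt A 0 with hA | hA
  · exact Eventually.of_forall fun n => (mul_nonpos_of_nonpos_of_nonneg hA (by positivity)).trans (by positivity)
  · have h2 : ∀ᶠ n : ℕ in atTop, (n : ℝ) ^ k / 2 ^ n ≤ 1 / A :=
      (h.eventually (ge_mem_nhds (by positivity : (0 : ℝ) < 1 / A)))
    filter_upwards [h2] with n hn
    rw [div_le_div_iff₀ (by positivity) hA, one_mul] at hn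
    linarith

/-! ### The asymptotic error bound -/

/-- **The error of Regev's reduction with the polynomial parameters is eventually `≤ 1/n^{c'}`**:
with `T = n^{c+c'+1}`, `N = n^{3c+2c'+3} q`, `η = 1/(16 n^c)`, `ε = 1/n^c`, `K = n`, and
polynomially bounded `q`, `m`,
`T (nq+1)/(4Nη²) + (1 - ε/2)^T + (T n + T(nq+1) N m) q / 2^n ≤ 1/n^{c'}` for all large `n`
(whenever `q n ≥ 1`). [cite: RegevLWE2009, §4 Lemma 4.1 (proof)] -/
theorem eventually_failureBound_le (c c' : ℕ) {q m : ℕ → ℕ} (hq : IsPolyBounded q) (hm : IsPolyBounded m) :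
    ∀ᶠ n : ℕ in atTop, 0 < q n →
      (Tpar c c' n : ℝ) * (((n : ℝ) * q n + 1) / (4 * (Npar c c' n (q n) : ℝ) * (1 / (16 * (n : ℝ) ^ c)) ^ 2)) +
          (1 - (1 / (n : ℝ) ^ c) / 2) ^ Tpar c c' n +
          ((Tpar c c' n * n + Tpar c c' n * (n * q n + 1) * Npar c c' n (q n) * m n : ℕ) : ℝ) * q n / 2 ^ n ≤
        1 / (n : ℝ) ^ c' := by
  obtain ⟨dq, hdq⟩ := IsPolyBounded.eventually_le_pow hq
  obtain ⟨dm, hdm⟩ := IsPolyBounded.eventually_le_pow hm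
  -- exponent of the polynomial bound on `L q`
  set D : ℕ := (c + c' + 1) + (3 * c + 2 * c' + 3) + 3 * dq + dm + 2 with hD
  have h2pow := eventually_mul_pow_le_two_pow (D + (c' + 1)) 3
  filter_upwards [hdq, hdm, h2pow, eventually_ge_atTop 131] with n hqn hmn h2n hn131 hq0
  -- real abbreviations
  have hn1 : (1 : ℝ) ≤ n := by exact_mod_cast (show 1 ≤ n by omega)
  have hn0 : (0 : ℝ) < n := by linarith
  have hq1 : (1 : ℝ) ≤ q n := by exact_mod_cast hq0
  set x : ℝ := (n : ℝ) with hx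
  set Q : ℝ := (q n : ℝ) with hQ
  have hxc : 0 < x ^ c := pow_pos hn0 c
  have hT : (Tpar c c' n : ℝ) = x ^ (c + c' + 1) := by simp [Tpar, hx]
  have hN : (Npar c c' n (q n) : ℝ) = x ^ (3 * c + 2 * c' + 3) * Q := by simp [Npar, hx, hQ]
  -- Term 1: `= 64 (xQ + 1)/(x^{c'+2} Q) ≤ 128 / x^{c'+1}`
  have h1 : (Tpar c c' n : ℝ) * ((x * Q + 1) / (4 * (Npar c c' n (q n) : ℝ) * (1 / (16 * x ^ c)) ^ 2)) ≤
      128 / x ^ (c' + 1) := by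
    rw [hT, hN]
    have hxQ : x * Q + 1 ≤ 2 * (x * Q) := by nlinarith
    rw [div_pow, one_pow, mul_pow, show (16 : ℝ) ^ 2 = 256 by norm_num, ← pow_mul]
    rw [show x ^ (c + c' + 1) * ((x * Q + 1) / (4 * (x ^ (3 * c + 2 * c' + 3) * Q) * (1 / (256 * x ^ (c * 2))))) =
        64 * (x * Q + 1) / (x ^ (c' + 2) * Q) by
      field_simp
      ring]
    rw [div_le_div_iff₀ (by positivity) (by positivity)]
    calc 64 * (x * Q + 1) * x ^ (c' + 1) ≤ 64 * (2 * (x * Q)) * x ^ (c' + 1) := by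
          apply mul_le_mul_of_nonneg_right _ (by positivity)
          linarith
      _ = 128 * (x ^ (c' + 2) * Q) := by ring
  -- Term 2: Bernoulli
  have h2 : (1 - (1 / x ^ c) / 2) ^ Tpar c c' n ≤ 2 / x ^ (c' + 1) := by
    have hε2 : 1 / x ^ c ≤ 2 := by
      rw [div_le_iff₀ hxc]
      have : 1 ≤ x ^ c := one_le_pow₀ hn1
      linarith
    have h := one_sub_half_pow_le (ε := 1 / x ^ c) (by positivity) hε2
      (Tpar_pos (c := c) (c' := c') (n := n) (by omega))
    refine h.trans (le_of_eq ?_)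
    rw [hT]
    field_simp
    ring
  -- Term 3: `L Q ≤ 3 x^D`, and `3 x^{D + c' + 1} ≤ 2^n`
  have hqx : Q ≤ x ^ dq := by rw [hQ, hx]; exact_mod_cast hqn
  have hmx : (m n : ℝ) ≤ x ^ dm := by rw [hx]; exact_mod_cast hmn
  have h3 : ((Tpar c c' n * n + Tpar c c' n * (n * q n + 1) * Npar c c' n (q n) * m n : ℕ) : ℝ) * Q / 2 ^ n ≤
      1 / x ^ (c' + 1) := by
    have hL : ((Tpar c c' n * n + Tpar c c' n * (n * q n + 1) * Npar c c' n (q n) * m n : ℕ) : ℝ) * Q ≤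
        3 * x ^ D := by
      push_cast
      rw [hT, hN]
      have hxQ1 : x * Q + 1 ≤ 2 * x ^ (dq + 1) := by
        have : x * Q ≤ x * x ^ dq := mul_le_mul_of_nonneg_left hqx hn0.le
        have h1' : (1 : ℝ) ≤ x ^ (dq + 1) := one_le_pow₀ hn1
        rw [pow_succ'] at h1' ⊢
        linarith
      have hA : x ^ (c + c' + 1) * x * Q ≤ x ^ D := by
        calc x ^ (c + c' + 1) * x * Q ≤ x ^ (c + c' + 1) * x * x ^ dq :=
              mul_le_mul_of_nonneg_left hqx (by positivity)
          _ = x ^ (c + c' + 1 + 1 + dq) := by ring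
          _ ≤ x ^ D := pow_le_pow_right₀ hn1 (by rw [hD]; omega)
      have hB : x ^ (c + c' + 1) * (x * Q + 1) * (x ^ (3 * c + 2 * c' + 3) * Q) * (m n : ℝ) * Q ≤ 2 * x ^ D := by
        calc x ^ (c + c' + 1) * (x * Q + 1) * (x ^ (3 * c + 2 * c' + 3) * Q) * (m n : ℝ) * Q
            ≤ x ^ (c + c' + 1) * (2 * x ^ (dq + 1)) * (x ^ (3 * c + 2 * c' + 3) * x ^ dq) * x ^ dm * x ^ dq := by
              gcongr
          _ = 2 * x ^ ((c + c' + 1) + (dq + 1) + (3 * c + 2 * c' + 3) + dq + dm + dq) := by ring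
          _ ≤ 2 * x ^ D := by
              refine mul_le_mul_of_nonneg_left (pow_le_pow_right₀ hn1 ?_) (by norm_num)
              rw [hD]; omega
      nlinarith [hA, hB]
    have hpow2 : (3 : ℝ) * x ^ (D + (c' + 1)) ≤ 2 ^ n := by simpa [hx] using h2n
    rw [div_le_div_iff₀ (by positivity) (by positivity), one_mul]
    calc ((Tpar c c' n * n + Tpar c c' n * (n * q n + 1) * Npar c c' n (q n) * m n : ℕ) : ℝ) * Q * x ^ (c' + 1)
        ≤ 3 * x ^ D * x ^ (c' + 1) := mul_le_mul_of_nonneg_right hL (by positivity)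
      _ = 3 * x ^ (D + (c' + 1)) := by ring
      _ ≤ 2 ^ n := hpow2
  -- assemble: `131 / x^{c'+1} ≤ 1 / x^{c'}` for `x ≥ 131`
  have hx131 : (131 : ℝ) ≤ x := by rw [hx]; exact_mod_cast hn131
  calc _ ≤ 128 / x ^ (c' + 1) + 2 / x ^ (c' + 1) + 1 / x ^ (c' + 1) := add_le_add (add_le_add h1 h2) h3
    _ = 131 / x ^ (c' + 1) := by ring
    _ ≤ 1 / x ^ c' := by
        rw [div_le_div_iff₀ (by positivity) (by positivity), pow_succ]
        nlinarith [pow_pos hn0 c']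

end RegevReduction

end LWE

end Literature.Computability.Cryptography
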